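import Mathlib
import Literature.NumberTheory.LFunctions.Zhang2022.Section13ZeroSumsL
import Literature.NumberTheory.LFunctions.Zhang2022.Section13MeanSquareL
import Literature.NumberTheory.LFunctions.Zhang2022.Section13ZeroSumBound
import HarnessLib

/-!
# Zhang (2022) §13 p. 75, `Z22:§13.u007` — the two remaining RECONSTRUCTED targets `U007b`, `U007c`
# of "the right side being estimated via Lemma 5.9, 6.1 and 3.3", PROVED BY NAME (GAP G-L3t6-3)

Topic `Literature/NumberTheory/LFunctions/Zhang2022` (Landau–Siegel audit tree; verdict-neutral).
Y. Zhang, *Discrete mean estimates and the Landau–Siegel zero*, arXiv:2211.02515v1 (2022)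
[Zhang2022LandauSiegel] — **an unrefereed manuscript under adjudication; nothing here asserts or denies
its Theorems 1–2 or says anything about Landau–Siegel zeros.** ZHANG-L discharge lane, WP14, ROW
G-L3t6-3 (§13 (13.11) "`𝔈 = o(𝔓)` … we can verify … For example, by (2.34) [U007] … the right side
being estimated via Lemma 5.9, 6.1 and 3.3", p. 75, tex L3806–L3817 — NOT carried out in print).

The GAP row's WANTED declarations are the three reconstructed shapes of `TypedSection13`
(`Typed.Section13.U007a/U007b/U007c c′`, typed ≠ asserted). State of the tree before this file:
`U007a` is a theorem by name (`u007a_of_prop22` / `u007a_eventually`, `Section13ZeroSumBound`);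
`U007b` exists only as the EDGE `u007b_of (h61 : Skeleton.Lemma61)` (`Section13U007b`), whose
hypothesis `Skeleton.Lemma61` AS TYPED (no (A), error `E₁(s,ψ)` at `s`) is not a tree theorem (the
tree has Lemma 6.1 in the reflected reading, `Section6Statements.lemma61_reflected`, GAP G-d08-2);
`U007c` was never proved. This file closes both, with NO hypothesis beyond the lane's standing
`0 ≤ c′ ∧ Skeleton.Prop22 c′` for `U007c` (and an `∃ c₀ ∀ c′ ≥ c₀` corollary via `prop22_eventually`):

* `u007b_holds (c′) : U007b c′` with the explicit exponent `k = 9` — NOT via Lemma 6.1 as typed: by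
  `|L(1−s−β₂,ψ̄)| = |L(1−s̄+β₂,ψ)|` (`norm_LFunction_inv_refl`, β₂ purely imaginary), `ab ≤ (a²+b²)/2`,
  and the programme's 𝔓-scale mean value `meanSq_L_le` (`Σ_{ψ∈T}|L(w,ψ)|² ≤ C𝔓𝓛⁹` on
  `|Re w − ½| ≤ α`, `|Im w − 2πt₀| < 𝓛₁ + 2`, itself from the reflected Lemma 6.1 + Lemma 3.3 (i)),
  then `𝔓 ≤ 6P²`;
* `u007c_of_prop22 (hc′ : 0 ≤ c′) (h22 : Prop22 c′) : U007c c′` with `k = 18` — the zero-side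
  counterpart: `zeroSum_L_sq_le_of_prop22 9 meanSq_L_le` (`Section13ZeroSumsL`, the (2.34)/residue
  conversion + Lemma 5.9 weight + the same mean value) at `β := β₂`, `‖β₂‖ ≤ 1` for large `D`, and
  `Σ_{i∈idx} = Σ_{ψ∈Ψ₁}Σ_{ρ∈𝔷(ψ)}` (`Finset.sum_sigma`);
* `u007c_eventually : ∃ c₀ ≥ 0, ∀ c′ ≥ c₀, U007c c′`.

Theorems only; no new definitions; no new named facts; axioms standard. With these the row's three
reconstructed targets are kernel theorems by name next to the leaf closer `eq1311Rel_holds`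
(`Section13Eq1311Holds`). NOT here: (13.11) itself (closed elsewhere), Theorems 1–2, zeros.

## References

* Y. Zhang, arXiv:2211.02515v1 (2022), §13 (13.11) and the last sentence of §13, p. 75,
  tex L3806–L3817; §6 Lemma 6.1 p. 31; §3 Lemma 3.3 (i) p. 14; §5 Lemma 5.9 p. 29.
  [cite: Zhang2022LandauSiegel, §13 p.75 (13.11), u007]
-/

noncomputable section

open Complex Real ComplexConjugate

namespace Literature.NumberTheory.LFunctions.Zhang2022.Typed.Section13

open Skeleton

/-! ## Sizes of `β₂` for large `D` -/

/-- For `D` large (depending on `c′`): `𝓛 ≥ 3` and `‖β₂‖ ≤ ½`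
(`β₂ = 2iα(1 + c′α𝓛)`, `α = π𝓛⁻⁹`). [cite: Zhang2022LandauSiegel, §2 (2.13) p.7] -/
theorem exists_forall_norm_beta2_le_half (c' : ℝ) :
    ∃ D₀ : ℕ, ∀ D : ℕ, D₀ ≤ D → 3 ≤ ell D ∧ ‖beta2 c' D‖ ≤ 1 / 2 := by
  obtain ⟨D₀, hD₀⟩ := exists_nat_forall_le_ell (π * |c'| + 3)
  refine ⟨D₀, fun D hD => ?_⟩
  have hM := hD₀ D hD
  have hc0 : 0 ≤ π * |c'| := mul_nonneg Real.pi_pos.le (abs_nonneg _)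
  have hℓ3 : 3 ≤ ell D := by linarith
  have hℓ1 : 1 ≤ ell D := by linarith
  have hℓpos : 0 < ell D := by linarith
  have hlogP : Real.log (bigP D) = ell D ^ 9 := by rw [bigP, Real.log_exp]
  have hα : alpha D = π / ell D ^ 9 := by rw [alpha, hlogP]
  have hℓ9pos : 0 < ell D ^ 9 := pow_pos hℓpos 9
  have hℓ8pos : 0 < ell D ^ 8 := pow_pos hℓpos 8
  have hαpos : 0 < alpha D := by rw [hα]; exact div_pos Real.pi_pos hℓ9pos
  refine ⟨hℓ3, ?_⟩
  -- `|c′α𝓛| = π|c′|/𝓛⁸ ≤ 1`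
  have hαℓ : alpha D * ell D = π / ell D ^ 8 := by
    rw [hα, div_mul_eq_mul_div, show (9 : ℕ) = 8 + 1 from rfl, pow_succ,
      mul_div_mul_right _ _ hℓpos.ne']
  have hℓ8 : ell D ≤ ell D ^ 8 := le_self_pow₀ hℓ1 (by norm_num)
  have he : |c' * alpha D * ell D| ≤ 1 := by
    rw [mul_assoc, abs_mul, hαℓ, abs_of_pos (div_pos Real.pi_pos hℓ8pos), ← mul_div_assoc,
      div_le_one hℓ8pos]
    nlinarith [abs_nonneg c', Real.pi_pos]
  -- `‖β₂‖ = 2α|1 + c′α𝓛| ≤ 4α`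
  have hnorm : ‖beta2 c' D‖ = 2 * alpha D * |1 + c' * alpha D * ell D| := by
    rw [beta2, norm_mul, norm_mul, norm_mul, Complex.norm_I, Complex.norm_real,
      Complex.norm_real, Real.norm_eq_abs, Real.norm_eq_abs, abs_of_pos hαpos]
    norm_num
  have habs : |1 + c' * alpha D * ell D| ≤ 2 := by
    have h := abs_le.mp he
    exact abs_le.mpr ⟨by linarith, by linarith⟩
  -- `4α = 4π/𝓛⁹ ≤ 4π/3⁹ ≤ ½`
  have h39 : (3 : ℝ) ^ 9 ≤ ell D ^ 9 := pow_le_pow_left₀ (by norm_num) hℓ3 9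
  have hα8 : alpha D ≤ 1 / 8 := by
    rw [hα, div_le_iff₀ hℓ9pos]
    nlinarith [Real.pi_lt_four]
  calc ‖beta2 c' D‖ = 2 * alpha D * |1 + c' * alpha D * ell D| := hnorm
    _ ≤ 2 * alpha D * 2 := by gcongr
    _ ≤ 1 / 2 := by linarith

/-! ## `U007b` by name, unconditionally -/

/-- **`Z22:§13.u007`, the estimate "via Lemma 6.1 and 3.3" (`U007b`), PROVED BY NAME with `k = 9`**:
for all large `D`, under (A), for `σ = ±α`, `|v| ≤ 𝓛₁`, `s = σ + s₀ + iv`,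
`Σ_{ψ∈Ψ₁} |L(s+β₂,ψ)·L(1−s−β₂,ψ̄)| ≤ C·P²·𝓛⁹`. Route (no Lemma 6.1 as typed): `|L(1−s−β₂,ψ̄)| =
|L(1−s̄+β₂,ψ)|` (β₂ purely imaginary), `|ab| ≤ (|a|²+|b|²)/2`, both points lie in the window of
`meanSq_L_le` (`|Re − ½| = α`, `|Im − 2πt₀| ≤ 𝓛₁ + ½`), and `𝔓 ≤ 6P²`.
[cite: Zhang2022LandauSiegel, §13 p. 75, last sentence; §8 p.44 tex L2244–2247] -/
theorem u007b_holds (c' : ℝ) : U007b c' := by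
  obtain ⟨C, D₁, hL⟩ := meanSq_L_le
  obtain ⟨D₂, hβ⟩ := exists_forall_norm_beta2_le_half c'
  set C' : ℝ := max C 0 with hC'
  have hC'0 : 0 ≤ C' := le_max_right _ _
  refine ⟨9, 6 * C', max D₁ D₂, fun D _ χ hD hq hp hA σ hσ v hv => ?_⟩
  have hD₁ : D₁ ≤ D := (le_max_left _ _).trans hD
  obtain ⟨hℓ3, hβn⟩ := hβ D ((le_max_right _ _).trans hD)
  have hℓ1 : 1 ≤ ell D := by linarith
  have hℓpos : 0 < ell D := by linarith
  -- `𝔓 = Σ_{p∼P} p ≤ 6P²` (at most `3P` members, each `≤ 2P`)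
  have hfrakP : frakP D ≤ 6 * bigP D ^ 2 := by
    have hP0 : 0 < bigP D := Real.exp_pos _
    rw [frakP_eq_sum_primeWindow]
    have hcard : ((primeWindow D).card : ℝ) ≤ 3 * bigP D := by
      have hℓ : (ell D ^ 68)⁻¹ ≤ 1 := inv_le_one_of_one_le₀ (one_le_pow₀ hℓ1)
      have h1 : (primeWindow D).card ≤ ⌈bigP D * (1 + (ell D ^ 68)⁻¹)⌉₊ := by
        unfold primeWindow
        refine (Finset.card_filter_le _ _).trans ?_
        rw [Nat.card_Ioo]; omega
      have h2 : (⌈bigP D * (1 + (ell D ^ 68)⁻¹)⌉₊ : ℝ) < bigP D * (1 + (ell D ^ 68)⁻¹) + 1 :=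
        Nat.ceil_lt_add_one (by positivity)
      have h3 : bigP D * (1 + (ell D ^ 68)⁻¹) ≤ 2 * bigP D := by nlinarith
      have h1' : ((primeWindow D).card : ℝ) ≤ ⌈bigP D * (1 + (ell D ^ 68)⁻¹)⌉₊ := by
        exact_mod_cast h1
      have hP1 : 1 ≤ bigP D := Real.one_le_exp (by positivity)
      linarith
    calc ∑ p ∈ primeWindow D, (p : ℝ) ≤ ∑ p ∈ primeWindow D, 2 * bigP D :=
          Finset.sum_le_sum fun p hp => le_two_mul_bigP_of_mem_primeWindow hℓ1 hp
      _ = (primeWindow D).card * (2 * bigP D) := by rw [Finset.sum_const, nsmul_eq_mul]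
      _ ≤ 3 * bigP D * (2 * bigP D) := by gcongr
      _ = 6 * bigP D ^ 2 := by ring
  have hα : 0 < alpha D := by
    rw [alpha, bigP, Real.log_exp]; exact div_pos Real.pi_pos (pow_pos hℓpos 9)
  have hβre : (beta2 c' D).re = 0 := beta2_re c' D
  have hβim : |(beta2 c' D).im| ≤ 1 / 2 := (Complex.abs_im_le_norm _).trans hβn
  have hσabs : |σ| = alpha D := by
    rcases hσ with h | h
    · rw [h, abs_of_pos hα]
    · rw [h, abs_neg, abs_of_pos hα]
  set s : ℂ := (σ : ℂ) + s0 D + v * I with hs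
  -- the two points
  set w₁ : ℂ := s + beta2 c' D with hw₁
  set w₂ : ℂ := 1 - conj s + beta2 c' D with hw₂
  have hsre : s.re = σ + 1 / 2 := by simp [hs, s0_re]
  have hsim : s.im = 2 * π * t0 D + v := by simp [hs, s0_im]
  have hw₁re : |w₁.re - 1 / 2| ≤ alpha D := by
    have : w₁.re - 1 / 2 = σ := by simp [hw₁, hsre, hβre]
    rw [this, hσabs]
  have hw₂re : |w₂.re - 1 / 2| ≤ alpha D := by
    have : w₂.re - 1 / 2 = -σ := by simp [hw₂, hsre, hβre]; ring
    rw [this, abs_neg, hσabs]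
  have hvβ : |v + (beta2 c' D).im| < ell1 D + 2 := by
    have h1 := abs_le.mp hv
    have h2 := abs_le.mp hβim
    rw [abs_lt]; constructor <;> linarith
  have hw₁im : |w₁.im - 2 * π * t0 D| < ell1 D + 2 := by
    have : w₁.im - 2 * π * t0 D = v + (beta2 c' D).im := by simp [hw₁, hsim]; ring
    rw [this]; exact hvβ
  have hw₂im : |w₂.im - 2 * π * t0 D| < ell1 D + 2 := by
    have : w₂.im - 2 * π * t0 D = v + (beta2 c' D).im := by simp [hw₂, hsim]; ring
    rw [this]; exact hvβ
  set T := finsetOf (PsiOne χ) with hT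
  have h1 := hL D χ hD₁ hq hp hA T w₁ hw₁re hw₁im
  have h2 := hL D χ hD₁ hq hp hA T w₂ hw₂re hw₂im
  have hP0 : 0 ≤ frakP D := frakP_nonneg D
  have hℓ9 : 0 ≤ ell D ^ 9 := pow_nonneg hℓpos.le 9
  have hCfP : C * frakP D * ell D ^ 9 ≤ C' * frakP D * ell D ^ 9 :=
    mul_le_mul_of_nonneg_right (mul_le_mul_of_nonneg_right (le_max_left _ _) hP0) hℓ9
  -- termwise `|L(w₁)·L⁻(1−s−β₂)| = |L(w₁)|·|L(w₂)| ≤ (|L(w₁)|² + |L(w₂)|²)/2`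
  have hterm : ∀ x ∈ T,
      ‖x.ψ.LFunction ((σ : ℂ) + s0 D + v * I + beta2 c' D) *
          x.ψ⁻¹.LFunction (1 - ((σ : ℂ) + s0 D + v * I) - beta2 c' D)‖ ≤
        (‖x.ψ.LFunction w₁‖ ^ 2 + ‖x.ψ.LFunction w₂‖ ^ 2) / 2 := by
    intro x _
    rw [norm_mul, ← hs, norm_LFunction_inv_refl x hβre s, ← hw₁, ← hw₂]
    nlinarith [sq_nonneg (‖x.ψ.LFunction w₁‖ - ‖x.ψ.LFunction w₂‖)]
  calc ∑ x ∈ T, ‖x.ψ.LFunction ((σ : ℂ) + s0 D + v * I + beta2 c' D) *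
          x.ψ⁻¹.LFunction (1 - ((σ : ℂ) + s0 D + v * I) - beta2 c' D)‖
      ≤ ∑ x ∈ T, (‖x.ψ.LFunction w₁‖ ^ 2 + ‖x.ψ.LFunction w₂‖ ^ 2) / 2 :=
        Finset.sum_le_sum hterm
    _ = ((∑ x ∈ T, ‖x.ψ.LFunction w₁‖ ^ 2) + ∑ x ∈ T, ‖x.ψ.LFunction w₂‖ ^ 2) / 2 := by
        rw [← Finset.sum_div, Finset.sum_add_distrib]
    _ ≤ (C' * frakP D * ell D ^ 9 + C' * frakP D * ell D ^ 9) / 2 := by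
        gcongr
        · exact h1.trans hCfP
        · exact h2.trans hCfP
    _ = C' * frakP D * ell D ^ 9 := by ring
    _ ≤ C' * (6 * bigP D ^ 2) * ell D ^ 9 := by gcongr
    _ = 6 * C' * bigP D ^ 2 * ell D ^ 9 := by ring

variable (c' : ℝ) in
/-- `U007b` — `_holds` alias of `u007b_holds` above under the fact's exact name, stated under the
prover's own binders as section variables (appended 2026-08-28, D-0026 bookkeeping: the proof term is the
existing theorem of this file; no statement, definition or attribute is edited; no new named fact; the
ledger's debt table listed the fact unproved). [cite: Zhang2022LandauSiegel, §13 p. 75, last sentence; §8 p.44 tex L2244–2247] -/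
theorem _root_.Literature.NumberTheory.LFunctions.Zhang2022.Typed.Section13.U007b_holds :
    _root_.Literature.NumberTheory.LFunctions.Zhang2022.Typed.Section13.U007b c' :=
  _root_.Literature.NumberTheory.LFunctions.Zhang2022.Typed.Section13.u007b_holds (c' := c')

/-! ## `U007c` by name -/

/-- **`Z22:§13.u007`, the conclusion shape `U007c`, PROVED BY NAME with `k = 18`**: for `c′ ≥ 0` with
`Skeleton.Prop22 c′`, for all large `D`, under (A),
`Σ_{(ψ,ρ)∈idx} |L(ρ+β₁,ψ)/L′(ρ,ψ)|·|L(ρ+β₂,ψ)|²·|ω(ρ)| ≤ C·𝔓·𝓛¹⁸` — the instance `β := β₂`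
(`Re β₂ = 0`, `‖β₂‖ ≤ ½` for large `D`) of `zeroSum_L_sq_le_of_prop22 9 meanSq_L_le`
((2.34)/residue conversion, Lemma 5.9 weight `𝓛⁹`, the 𝔓-scale mean value of `L`).
[cite: Zhang2022LandauSiegel, §13 p. 75, last sentence, tex L3811–L3817] -/
theorem u007c_of_prop22 {c' : ℝ} (hc' : 0 ≤ c') (h22 : Prop22 c') : U007c c' := by
  obtain ⟨C, D₁, hZ⟩ := zeroSum_L_sq_le_of_prop22 9 meanSq_L_le hc' h22
  obtain ⟨D₂, hβ⟩ := exists_forall_norm_beta2_le_half c'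
  refine ⟨18, C, max D₁ D₂, fun D _ χ hD hq hp hA => ?_⟩
  have hD₁ : D₁ ≤ D := (le_max_left _ _).trans hD
  obtain ⟨-, hβn⟩ := hβ D ((le_max_right _ _).trans hD)
  have hβ1 : ‖beta2 c' D‖ ≤ 1 := hβn.trans (by norm_num)
  have h := hZ D χ hD₁ hq hp hA (beta2 c' D) (beta2_re c' D) hβ1
  rw [idx, Finset.sum_sigma]
  exact h

/-- **`U007c` eventually in `c′`**: there is `c₀ ≥ 0` with `U007c c′` for every `c′ ≥ c₀`
(`Skeleton.prop22_eventually`). [cite: Zhang2022LandauSiegel, §13 p. 75, last sentence] -/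
theorem u007c_eventually : ∃ c₀ : ℝ, 0 ≤ c₀ ∧ ∀ c' : ℝ, c₀ ≤ c' → U007c c' := by
  obtain ⟨c₀, hc₀, h⟩ := prop22_eventually
  exact ⟨c₀, hc₀, fun c' hc' => u007c_of_prop22 (hc₀.trans hc') (h c' hc')⟩

/-- **`U007b` in the same eventual shape** (trivially, from `u007b_holds`).
[cite: Zhang2022LandauSiegel, §13 p. 75, last sentence] -/
theorem u007b_eventually : ∃ c₀ : ℝ, 0 ≤ c₀ ∧ ∀ c' : ℝ, c₀ ≤ c' → U007b c' :=
  ⟨0, le_rfl, fun c' _ => u007b_holds c'⟩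

end Literature.NumberTheory.LFunctions.Zhang2022.Typed.Section13
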